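import Summits.NavierStokesRegularity.NavierStokesRegularity.Theorems.HeredityAtOneT.Negative.LiveHeredityFalseOfLiveSubfloorStage
import Summits.NavierStokesRegularity.NavierStokesRegularity.Theorems.HeredityAtOneT.Negative.DeadSliceBackwardStage

/-!
# The live-class refutation templates with liveness moved from the RUN to the DATUM (unforced designs)

Cell `ns-blowup`, seat `ns-blowup-refuter4` (g11, K225; ledger refuter of record for route `PalasekTowerBreakdown` rev 19,
cruxes stmt-NavierStokesRegularity-20304 `HeredityAtOneT` / -20305 `HeredityFromTwoT`). Negative-lane SUPPORT (`--supports 20304`):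
theorems only, no definition, no named fact, no Theses import; nothing about blow-up or regularity is asserted.

`LiveHeredityFalseOfLiveSubfloorStage` (K209) refutes the repaired heredity shapes `LiveHeredityAtGAt R k`,
`LiveHeredityFromGAt R k₀` and the tuned pair from a witness `H_sub^live(R, k)` whose liveness clause
`hs : LiveStageAt R S s` — "the readout slice of the registered stage at `τ_k` is not axisymmetric-swirl-free in any rigid
placement" — is a property of the RUN, readable only after the stage has been computed. `DeadSliceBackwardStage` (K224)
proved that for an UNFORCED design (`S.f = 0`) liveness propagates from the datum: `¬ DeadSlice S.u₀ → LiveStageAt R S s`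
(backward uniqueness in the Sobolev class + rigid covariance). Composing the two moves the liveness clause to the DATUM,
where it is decidable at design time (a datum that is not axisymmetric AND swirl-free in any placement — e.g. any datum
with swirl, or any non-axisymmetric datum), and the quietness clause `S.Quiet` becomes automatic (`quiet_of_force_eq_zero`).
-/

noncomputable section

namespace Summit.NavierStokesRegularity.HeredityAtOneTLiveDatumSubfloor

open Set MeasureTheory
open scoped ENNReal NNReal
open Literature.Analysis.FluidPDE
open Summit.NavierStokesRegularity.FluidComputer.PalasekTowerClayBridge
open Summit.NavierStokesRegularity.HeredityAtOneTLiveSubfloor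
open Summit.NavierStokesRegularity.HeredityAtOneTDeadSliceBackwardStage

/-- An unforced schedule is quiet. [folklore] -/
theorem quiet_of_force_eq_zero {R : TowerRates} {S : Schedule R} (hf : S.f = 0) : S.Quiet :=
  fun t _ => by rw [hf]; rfl

section Witness

variable {R : TowerRates} {S : Schedule R} {k : ℕ}
  {u : ℝ → EuclideanSpace ℝ (Fin 3) → EuclideanSpace ℝ (Fin 3)} {p : ℝ → EuclideanSpace ℝ (Fin 3) → ℝ}

/-- **`H_sub^{live datum}(R, k) → ¬ LiveHeredityAtGAt R k`**: a pinned rigid UNFORCED design whose datum is not a dead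
slice, with a registered level-`k` stage and a sub-floor competitor from the datum, refutes the repaired heredity at level
`k` (the stage is live by `liveStageAt_of_not_deadSlice`). [cite: Sohr2001, Ch. V Thm. 1.5.1] [cite: Temam1997, Ch. III §6.2 with Lemma 6.2 (pp. 172–175)] -/
theorem not_liveHeredityAtGAt_of_liveDatum_subfloor (hP : S.Pins 8 (6 / 5)) (hR : S.Rigid) (hf : S.f = 0)
    (hlive : ¬ DeadSlice S.u₀) (s : Stage 1 R S (Margins.routeG R) k)
    (hcl : IsClassicalNSSolutionOn (Icc 0 (S.τ (k + 1))) 1 0 u p) (hu0 : u 0 = S.u₀)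
    (hE : ∃ C : ℝ≥0∞, C < ⊤ ∧ ∀ t ∈ Icc 0 (S.τ (k + 1)), ∫⁻ x, ‖u t x‖ₑ ^ 2 ≤ C)
    (hsub : ∀ x, ‖x‖ ≤ S.radius → ‖u (S.τ (k + 1)) x‖ < S.c₁ * R.Y (k + 1)) :
    ¬ LiveHeredityAtGAt R k :=
  not_liveHeredityAtGAt_of_live_subfloor hP hR (quiet_of_force_eq_zero hf) s
    (liveStageAt_of_not_deadSlice S hf s hlive) (by rw [hf]; exact hcl) hu0 hE hsub

/-- **`H_sub^{live datum}(R, k) → ¬ LiveHeredityFromGAt R k₀`** for every `k₀ ≤ k`. [cite: Sohr2001, Ch. V Thm. 1.5.1]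
[cite: Temam1997, Ch. III §6.2 with Lemma 6.2 (pp. 172–175)] -/
theorem not_liveHeredityFromGAt_of_liveDatum_subfloor {k₀ : ℕ} (hk : k₀ ≤ k) (hP : S.Pins 8 (6 / 5)) (hR : S.Rigid)
    (hf : S.f = 0) (hlive : ¬ DeadSlice S.u₀) (s : Stage 1 R S (Margins.routeG R) k)
    (hcl : IsClassicalNSSolutionOn (Icc 0 (S.τ (k + 1))) 1 0 u p) (hu0 : u 0 = S.u₀)
    (hE : ∃ C : ℝ≥0∞, C < ⊤ ∧ ∀ t ∈ Icc 0 (S.τ (k + 1)), ∫⁻ x, ‖u t x‖ₑ ^ 2 ≤ C)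
    (hsub : ∀ x, ‖x‖ ≤ S.radius → ‖u (S.τ (k + 1)) x‖ < S.c₁ * R.Y (k + 1)) :
    ¬ LiveHeredityFromGAt R k₀ :=
  not_liveHeredityFromGAt_of_live_subfloor hk hP hR (quiet_of_force_eq_zero hf) s
    (liveStageAt_of_not_deadSlice S hf s hlive) (by rw [hf]; exact hcl) hu0 hE hsub

/-- The repaired PAIR `LiveHeredityAtGAt R 1 ∧ LiveHeredityFromGAt R 2` fails as soon as some level `k ≥ 1` of a pinned
rigid unforced design with a LIVE DATUM carries a registered stage with a sub-floor competitor. [cite: Sohr2001, Ch. V Thm. 1.5.1]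
[cite: Temam1997, Ch. III §6.2 with Lemma 6.2 (pp. 172–175)] -/
theorem not_liveHeredity_pair_of_liveDatum_subfloor (hk : 1 ≤ k) (hP : S.Pins 8 (6 / 5)) (hR : S.Rigid)
    (hf : S.f = 0) (hlive : ¬ DeadSlice S.u₀) (s : Stage 1 R S (Margins.routeG R) k)
    (hcl : IsClassicalNSSolutionOn (Icc 0 (S.τ (k + 1))) 1 0 u p) (hu0 : u 0 = S.u₀)
    (hE : ∃ C : ℝ≥0∞, C < ⊤ ∧ ∀ t ∈ Icc 0 (S.τ (k + 1)), ∫⁻ x, ‖u t x‖ₑ ^ 2 ≤ C)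
    (hsub : ∀ x, ‖x‖ ≤ S.radius → ‖u (S.τ (k + 1)) x‖ < S.c₁ * R.Y (k + 1)) :
    ¬ (LiveHeredityAtGAt R 1 ∧ LiveHeredityFromGAt R 2) :=
  not_liveHeredity_pair_of_live_subfloor hk hP hR (quiet_of_force_eq_zero hf) s
    (liveStageAt_of_not_deadSlice S hf s hlive) (by rw [hf]; exact hcl) hu0 hE hsub

end Witness

/-! ## At the re-based register `TowerRates.tuned` -/

section Tuned

variable {S : Schedule TowerRates.tuned} {k : ℕ}
  {u : ℝ → EuclideanSpace ℝ (Fin 3) → EuclideanSpace ℝ (Fin 3)} {p : ℝ → EuclideanSpace ℝ (Fin 3) → ℝ}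

/-- **`H_sub^{live datum}(tuned, 1) → ¬ LiveHeredityAtOneT`.** [cite: Sohr2001, Ch. V Thm. 1.5.1]
[cite: Temam1997, Ch. III §6.2 with Lemma 6.2 (pp. 172–175)] -/
theorem liveHeredityAtOneT_false_of_liveDatum_subfloor (hP : S.Pins 8 (6 / 5)) (hR : S.Rigid) (hf : S.f = 0)
    (hlive : ¬ DeadSlice S.u₀) (s : Stage 1 TowerRates.tuned S (Margins.routeG TowerRates.tuned) 1)
    (hcl : IsClassicalNSSolutionOn (Icc 0 (S.τ 2)) 1 0 u p) (hu0 : u 0 = S.u₀)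
    (hE : ∃ C : ℝ≥0∞, C < ⊤ ∧ ∀ t ∈ Icc 0 (S.τ 2), ∫⁻ x, ‖u t x‖ₑ ^ 2 ≤ C)
    (hsub : ∀ x, ‖x‖ ≤ S.radius → ‖u (S.τ 2) x‖ < S.c₁ * TowerRates.tuned.Y 2) :
    ¬ LiveHeredityAtOneT :=
  not_liveHeredityAtGAt_of_liveDatum_subfloor hP hR hf hlive s hcl hu0 hE hsub

/-- **`H_sub^{live datum}(tuned, k)`, `k ≥ 2` → ¬ LiveHeredityFromTwoT.** [cite: Sohr2001, Ch. V Thm. 1.5.1]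
[cite: Temam1997, Ch. III §6.2 with Lemma 6.2 (pp. 172–175)] -/
theorem liveHeredityFromTwoT_false_of_liveDatum_subfloor (hk : 2 ≤ k) (hP : S.Pins 8 (6 / 5)) (hR : S.Rigid)
    (hf : S.f = 0) (hlive : ¬ DeadSlice S.u₀) (s : Stage 1 TowerRates.tuned S (Margins.routeG TowerRates.tuned) k)
    (hcl : IsClassicalNSSolutionOn (Icc 0 (S.τ (k + 1))) 1 0 u p) (hu0 : u 0 = S.u₀)
    (hE : ∃ C : ℝ≥0∞, C < ⊤ ∧ ∀ t ∈ Icc 0 (S.τ (k + 1)), ∫⁻ x, ‖u t x‖ₑ ^ 2 ≤ C)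
    (hsub : ∀ x, ‖x‖ ≤ S.radius → ‖u (S.τ (k + 1)) x‖ < S.c₁ * TowerRates.tuned.Y (k + 1)) :
    ¬ LiveHeredityFromTwoT :=
  not_liveHeredityFromGAt_of_liveDatum_subfloor hk hP hR hf hlive s hcl hu0 hE hsub

/-- **`H_sub^{live datum}(tuned, k)`, `k ≥ 1` → the repaired tuned pair `LiveHeredityAtOneT ∧ LiveHeredityFromTwoT` fails.**
[cite: Sohr2001, Ch. V Thm. 1.5.1] [cite: Temam1997, Ch. III §6.2 with Lemma 6.2 (pp. 172–175)] -/
theorem liveHeredity_pairT_false_of_liveDatum_subfloor (hk : 1 ≤ k) (hP : S.Pins 8 (6 / 5)) (hR : S.Rigid)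
    (hf : S.f = 0) (hlive : ¬ DeadSlice S.u₀) (s : Stage 1 TowerRates.tuned S (Margins.routeG TowerRates.tuned) k)
    (hcl : IsClassicalNSSolutionOn (Icc 0 (S.τ (k + 1))) 1 0 u p) (hu0 : u 0 = S.u₀)
    (hE : ∃ C : ℝ≥0∞, C < ⊤ ∧ ∀ t ∈ Icc 0 (S.τ (k + 1)), ∫⁻ x, ‖u t x‖ₑ ^ 2 ≤ C)
    (hsub : ∀ x, ‖x‖ ≤ S.radius → ‖u (S.τ (k + 1)) x‖ < S.c₁ * TowerRates.tuned.Y (k + 1)) :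
    ¬ (LiveHeredityAtOneT ∧ LiveHeredityFromTwoT) :=
  not_liveHeredity_pair_of_liveDatum_subfloor hk hP hR hf hlive s hcl hu0 hE hsub

end Tuned

end Summit.NavierStokesRegularity.HeredityAtOneTLiveDatumSubfloor

end
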